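import Summits.BirchSwinnertonDyer.BirchSwinnertonDyer.Theorems.CongruentShaFreeCutUnrSeriesWeierstrass
import Summits.BirchSwinnertonDyer.BirchSwinnertonDyer.Theorems.CongruentShaFreeCutPowerMapPolynomialRigidity
import Summits.BirchSwinnertonDyer.Rank1Residual.Additive.PowerMapRigidity
import HarnessLib

set_option linter.dupNamespace false -- `Summit.BirchSwinnertonDyer.BirchSwinnertonDyer.Theorems.…` (summit = sub)
set_option autoImplicit false

/-!
# Route `CongruentShaFreeCut` (rung S2) — LEMMA R∞, algebraic core: rigidity of the POWER-TYPE functional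
# equation `θ · 𝓛'(Φ) · 𝓛^p = 𝓛'^p · 𝓛(Φ)` in `Λ^nr = R₀⟦T⟧` (`Φ = (1+T)^p − 1`, `θ ∈ ℂ_pˣ`)

Cell `bsd-cn100`, prover seat `bsd-cn100-transfer` (g11), plan g15 RULING-4 (2026-08-27T01:22:06Z)
«COMMISSIONED … LEMMA R∞ (series rigidity across periods)», file 3 (pure algebra over `R₀ = unrIntegers p`).
Supports, does not close, stmt-BirchSwinnertonDyer-19079. THEOREMS ONLY; imports no `Theses` module.
PARTITION: none — RANK axis. HONEST FRAMING: commutative algebra; nothing about BSD.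

THE RESULT (`exists_C_pow_mul_eq_of_powerMap_identity`): if `𝓛, 𝓛' ∈ R₀⟦T⟧` are non-zero, `θ ∈ ℂ_p`
is non-zero, and — read in `ℂ_p⟦T⟧` — `θ · 𝓛'(Φ) · 𝓛^p = 𝓛'^p · 𝓛(Φ)`, then
`p^a · 𝓛' = p^b · w · 𝓛` for some `a b : ℕ` and a UNIT `w ∈ R₀⟦T⟧ˣ`. Proof (Washington §7.1–7.2 toolkit):
`p`-contents `𝓛 = p^μ 𝓛₀`, `𝓛' = p^{μ'} 𝓛₀'` (file 1); Weierstrass `𝓛₀ = P·v`, `𝓛₀' = P'·v'` (Mathlib,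
`R₀` adically complete by file 1); the power map transports Weierstrass factorizations (§1, port of
b2b-bsdres `…Additive.PowerMapRigidity` §1 from `ℤ_p` to `R₀`), so both sides are
(distinguished polynomial) × (unit) up to the scalars `θ p^{μ'+pμ}`, `p^{pμ'+μ}`; comparing the top
coefficients shows the scalar ratio is a unit of `R₀` (§2), and UNIQUENESS of Weierstrass factorization gives
`P'(Φ)·P^p = P'^p·P(Φ)`, whence `P = P'` by the polynomial rigidity of file 2
(`eq_of_comp_powerMap_mul_pow_eq`; roots of distinguished polynomials lie in the open disc, §2); so
`p^μ 𝓛' = p^{μ'} (v' v⁻¹) 𝓛`.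

References: [Washington1997] §7.1 (Thm. 7.3, Weierstrass preparation), §7.2 (the `p`-power map).
-/

noncomputable section

open scoped Classical

open PowerSeries Literature.NumberTheory.EllipticCurves
  Summit.BirchSwinnertonDyer.Rank1Residual.X2.HidaLimitAlgebra
  Summit.BirchSwinnertonDyer.Rank1Residual.Additive
  Summit.BirchSwinnertonDyer.BirchSwinnertonDyer.Theorems.CongruentShaFreeCutUnrSeriesWeierstrass
  Summit.BirchSwinnertonDyer.BirchSwinnertonDyer.Theorems.CongruentShaFreeCutPowerMapPolynomialRigidity

namespace Summit.BirchSwinnertonDyer.BirchSwinnertonDyer.Theorems.CongruentShaFreeCutPowerMapSeriesRigidity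

variable {p : ℕ} [hp : Fact p.Prime]

/-! ### §1 The `p`-power map on `R₀⟦T⟧`: distinguished, transports Weierstrass factorizations -/

/-- **`Φ = (1+X)^p − 1 ∈ R₀[X]` is distinguished of degree `p`** (monic; middle coefficients
`binom(p,i) ∈ pℤ ⊂ 𝔪 = (p)`). Port of b2b-bsdres's `ℤ_p` version. [cite: Washington1997, §7.2 (the p-power map)] -/
theorem isDistinguishedAt_powerMap :
    (haveI := isDiscreteValuationRing_unrIntegers (p := p);
      ((1 + Polynomial.X : Polynomial (unrIntegers p)) ^ p - 1).IsDistinguishedAt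
        (IsLocalRing.maximalIdeal (unrIntegers p))) ∧
    ((1 + Polynomial.X : Polynomial (unrIntegers p)) ^ p - 1).natDegree = p := by
  haveI := isDiscreteValuationRing_unrIntegers (p := p)
  have hmonic1 : ((1 + Polynomial.X : Polynomial (unrIntegers p)) ^ p).Monic := by
    rw [add_comm]; exact (Polynomial.monic_X_add_C 1).pow p
  have hdeg1 : ((1 + Polynomial.X : Polynomial (unrIntegers p)) ^ p).natDegree = p := by
    rw [add_comm, ← Polynomial.C_1, Polynomial.natDegree_pow, Polynomial.natDegree_X_add_C, mul_one]
  have hlt : (1 : Polynomial (unrIntegers p)).degree <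
      ((1 + Polynomial.X : Polynomial (unrIntegers p)) ^ p).degree := by
    rw [Polynomial.degree_one, Polynomial.degree_eq_natDegree hmonic1.ne_zero, hdeg1]
    exact_mod_cast hp.out.pos
  have hmonic : ((1 + Polynomial.X : Polynomial (unrIntegers p)) ^ p - 1).Monic := hmonic1.sub_of_left hlt
  have hdeg : ((1 + Polynomial.X : Polynomial (unrIntegers p)) ^ p - 1).natDegree = p := by
    rw [Polynomial.natDegree_eq_of_degree_eq (Polynomial.degree_sub_eq_left_of_degree_lt hlt), hdeg1]
  refine ⟨⟨⟨fun {n} hn ↦ ?_⟩, hmonic⟩, hdeg⟩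
  rw [hdeg] at hn
  rw [Polynomial.coeff_sub, Polynomial.coeff_one_add_X_pow, Polynomial.coeff_one]
  rcases Nat.eq_zero_or_pos n with rfl | hn0
  · simp
  · rw [if_neg hn0.ne', sub_zero, maximalIdeal_eq_span_p, Ideal.mem_span_singleton]
    exact Nat.cast_dvd_cast (hp.out.dvd_choose_self hn0.ne' hn)

/-- The Weierstrass factorization of `G ∈ R₀⟦T⟧` transported along the `p`-power map:
`G(Φ) = P(Φ) · U(Φ)` is again (distinguished) × (unit). Port of b2b-bsdres's `ℤ_p` version
`isWeierstrassFactorization_subst_one_add_X_pow_prime_sub_one`. [cite: Washington1997, §7.2 (the p-power map)] -/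
theorem isWeierstrassFactorization_subst_powerMap {G : UnrSeries p}
    {P : Polynomial (unrIntegers p)} {U : UnrSeries p}
    (H : haveI := isDiscreteValuationRing_unrIntegers (p := p); G.IsWeierstrassFactorization P U) :
    (haveI := isDiscreteValuationRing_unrIntegers (p := p);
      PowerSeries.IsWeierstrassFactorization
        (G.subst ((1 + X : UnrSeries p) ^ p - 1) : UnrSeries p)
        (P.comp ((1 + Polynomial.X : Polynomial (unrIntegers p)) ^ p - 1))
        (U.subst ((1 + X : UnrSeries p) ^ p - 1))) := by
  haveI := isDiscreteValuationRing_unrIntegers (p := p)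
  obtain ⟨hdist, hdeg⟩ := isDistinguishedAt_powerMap (p := p)
  refine ⟨isDistinguishedAt_comp H.isDistinguishedAt hdist (by rw [hdeg]; exact hp.out.ne_zero),
    isUnit_subst_one_add_X_pow_sub_one p H.isUnit, ?_⟩
  rw [H.eq_mul, subst_mul (hasSubst_one_add_X_pow_sub_one p), subst_coe_eq_coe_comp]

/-- Powers of a Weierstrass factorization. [folklore] -/
theorem isWeierstrassFactorization_pow_succ {A : Type*} [CommRing A] [IsLocalRing A] {g : A⟦X⟧}
    {f : Polynomial A} {h : A⟦X⟧} (H : g.IsWeierstrassFactorization f h) (n : ℕ) :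
    (g ^ (n + 1)).IsWeierstrassFactorization (f ^ (n + 1)) (h ^ (n + 1)) := by
  induction n with
  | zero => simpa using H
  | succ k ih =>
    have := ih.mul H
    simpa [pow_succ] using this

/-- Positive powers of a Weierstrass factorization. [folklore] -/
theorem isWeierstrassFactorization_pow {A : Type*} [CommRing A] [IsLocalRing A] {g : A⟦X⟧}
    {f : Polynomial A} {h : A⟦X⟧} (H : g.IsWeierstrassFactorization f h) {n : ℕ} (hn : n ≠ 0) :
    (g ^ n).IsWeierstrassFactorization (f ^ n) (h ^ n) := by
  obtain ⟨k, rfl⟩ := Nat.exists_eq_succ_of_ne_zero hn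
  exact isWeierstrassFactorization_pow_succ H k

/-! ### §2 Top coefficients; roots of distinguished polynomials -/

/-- In a Weierstrass factorization `g = f · h` over a local ring, the coefficient of `T^{deg f}` in `g`
is a UNIT (mod `𝔪` the series `g` is `T^{deg f} · h̄` with `h̄(0) ≠ 0`). [cite: Washington1997, §7.1 (Thm. 7.3)] -/
theorem isUnit_coeff_natDegree {A : Type*} [CommRing A] [IsLocalRing A] {g : A⟦X⟧}
    {f : Polynomial A} {h : A⟦X⟧} (H : g.IsWeierstrassFactorization f h) :
    IsUnit (coeff f.natDegree g) := by
  have hres : IsLocalRing.residue A (coeff f.natDegree g) =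
      IsLocalRing.residue A (constantCoeff h) := by
    have hf : Polynomial.map (IsLocalRing.residue A) f = Polynomial.X ^ f.natDegree :=
      H.isDistinguishedAt.map_eq_X_pow
    have h1 : PowerSeries.map (IsLocalRing.residue A) g =
        X ^ f.natDegree * PowerSeries.map (IsLocalRing.residue A) h := by
      rw [H.eq_mul, map_mul, ← Polynomial.polynomial_map_coe, hf, Polynomial.coe_pow, Polynomial.coe_X]
    have h2 := congrArg (coeff f.natDegree) h1
    rw [coeff_map, coeff_X_pow_mul', if_pos le_rfl, Nat.sub_self, coeff_map,
      coeff_zero_eq_constantCoeff] at h2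
    exact h2
  have hh : IsUnit (constantCoeff h) := isUnit_iff_constantCoeff.mp H.isUnit
  by_contra hnu
  have hmem : coeff f.natDegree g ∈ IsLocalRing.maximalIdeal A := hnu
  rw [← IsLocalRing.residue_eq_zero_iff] at hmem
  rw [hmem, eq_comm, IsLocalRing.residue_eq_zero_iff] at hres
  exact hres hh

/-- The roots in `ℂ_p` of a polynomial DISTINGUISHED at the maximal ideal `(p)` of `R₀` lie in the open
unit disc: if `P(α) = 0` with `‖α‖ ≥ 1` then `‖α‖^N = ‖∑_{n<N} a_n α^n‖ ≤ p⁻¹ ‖α‖^N`. [cite: Washington1997, §7.1 (distinguished polynomials)] -/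
theorem norm_root_lt_one_of_isDistinguishedAt {P : Polynomial (unrIntegers p)}
    (hP : haveI := isDiscreteValuationRing_unrIntegers (p := p);
      P.IsDistinguishedAt (IsLocalRing.maximalIdeal (unrIntegers p)))
    {α : ℂ_[p]} (hα : (P.map (unrIntegers p).subtype).IsRoot α) : ‖α‖ < 1 := by
  haveI := isDiscreteValuationRing_unrIntegers (p := p)
  have hp' : p.Prime := hp.out
  have hpinv1 : (p : ℝ)⁻¹ < 1 := inv_lt_one_of_one_lt₀ (by exact_mod_cast hp'.one_lt)
  have hpinv0 : (0 : ℝ) ≤ (p : ℝ)⁻¹ := inv_nonneg.mpr (by exact_mod_cast hp'.pos.le)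
  by_contra hge
  push Not at hge
  -- `α^N = - ∑_{n<N} a_n α^n`
  have hmonic := hP.monic
  have heval : (P.map (unrIntegers p).subtype).eval α = 0 := hα
  rw [Polynomial.eval_map, Polynomial.eval₂_eq_sum_range, Finset.sum_range_succ] at heval
  have hlead : (unrIntegers p).subtype (P.coeff P.natDegree) = 1 := by
    rw [Polynomial.Monic.coeff_natDegree hmonic, map_one]
  rw [hlead, one_mul] at heval
  have hsum : α ^ P.natDegree =
      -∑ n ∈ Finset.range P.natDegree, (unrIntegers p).subtype (P.coeff n) * α ^ n := by
    linear_combination heval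
  -- each term has norm `≤ p⁻¹ ‖α‖^N`
  have hterm : ∀ n ∈ Finset.range P.natDegree, ‖(unrIntegers p).subtype (P.coeff n) * α ^ n‖ ≤
      (p : ℝ)⁻¹ * ‖α‖ ^ P.natDegree := by
    intro n hn
    rw [Finset.mem_range] at hn
    have hmem : P.coeff n ∈ IsLocalRing.maximalIdeal (unrIntegers p) := hP.mem hn
    rw [maximalIdeal_eq_span_p, ← pow_one (((p : ℕ) : unrIntegers p))] at hmem
    have hcoef : ‖((P.coeff n : unrIntegers p) : ℂ_[p])‖ ≤ (p : ℝ)⁻¹ := by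
      simpa using norm_le_of_mem_span_pow hmem
    rw [norm_mul, norm_pow]
    have hαN : ‖α‖ ^ n ≤ ‖α‖ ^ P.natDegree := pow_le_pow_right₀ hge hn.le
    exact mul_le_mul hcoef hαN (pow_nonneg (norm_nonneg _) _) hpinv0
  have hle : ‖α‖ ^ P.natDegree ≤ (p : ℝ)⁻¹ * ‖α‖ ^ P.natDegree := by
    calc ‖α‖ ^ P.natDegree = ‖α ^ P.natDegree‖ := (norm_pow α _).symm
      _ = ‖∑ n ∈ Finset.range P.natDegree, (unrIntegers p).subtype (P.coeff n) * α ^ n‖ := by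
          rw [hsum, norm_neg]
      _ ≤ (p : ℝ)⁻¹ * ‖α‖ ^ P.natDegree :=
          IsUltrametricDist.norm_sum_le_of_forall_le_of_nonneg
            (mul_nonneg hpinv0 (pow_nonneg (norm_nonneg _) _)) hterm
  have hpos : 0 < ‖α‖ ^ P.natDegree := pow_pos (lt_of_lt_of_le one_pos hge) _
  nlinarith

/-! ### §3 The rigidity theorem -/

/-- **Rigidity of the power-type functional equation in `Λ^nr = R₀⟦T⟧`.** Let `𝓛, 𝓛' ∈ R₀⟦T⟧` be
non-zero and `θ ∈ ℂ_p` non-zero, and suppose that in `ℂ_p⟦T⟧`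
`θ · 𝓛'((1+T)^p − 1) · 𝓛^p = 𝓛'^p · 𝓛((1+T)^p − 1)`. Then `p^a · 𝓛' = p^b · (w · 𝓛)` for some
`a b : ℕ` and a unit `w` of `R₀⟦T⟧` (in fact `a = μ(𝓛)`, `b = μ(𝓛')`, `w = v'·v⁻¹` for the Weierstrass units).
See the module docstring for the proof. [cite: Washington1997, §7.1 (Thm. 7.3), §7.2 (the p-power map)] -/
theorem exists_C_pow_mul_eq_of_powerMap_identity {L L' : UnrSeries p} (hL : L ≠ 0) (hL' : L' ≠ 0)
    {θ : ℂ_[p]}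
    (hid : PowerSeries.C θ *
        PowerSeries.map (unrIntegers p).subtype (L'.subst ((1 + X : UnrSeries p) ^ p - 1)) *
        PowerSeries.map (unrIntegers p).subtype L ^ p =
      PowerSeries.map (unrIntegers p).subtype L' ^ p *
        PowerSeries.map (unrIntegers p).subtype (L.subst ((1 + X : UnrSeries p) ^ p - 1))) :
    ∃ (a b : ℕ) (w : UnrSeries p), IsUnit w ∧
      PowerSeries.C (((p : ℕ) : unrIntegers p) ^ a) * L' =
        PowerSeries.C (((p : ℕ) : unrIntegers p) ^ b) * (w * L) := by
  haveI := isDiscreteValuationRing_unrIntegers (p := p)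
  haveI : IsAdicComplete (IsLocalRing.maximalIdeal (unrIntegers p)) (unrIntegers p) :=
    isAdicComplete_maximalIdeal
  have hp0 : p ≠ 0 := hp.out.ne_zero
  have hι : Function.Injective ((unrIntegers p).subtype) := Subtype.val_injective
  have hπ0 : (((p : ℕ) : unrIntegers p)) ≠ 0 := (irreducible_natCast_p (p := p)).ne_zero
  -- `p`-contents and Weierstrass factorizations
  obtain ⟨μ, L₀, hLμ, hL₀⟩ := UnrSeries.exists_eq_C_pow_mul_map_residue_ne_zero hL
  obtain ⟨μ', L₀', hLμ', hL₀'⟩ := UnrSeries.exists_eq_C_pow_mul_map_residue_ne_zero hL'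
  obtain ⟨P, v, HPv⟩ := L₀.exists_isWeierstrassFactorization hL₀
  obtain ⟨P', v', HPv'⟩ := L₀'.exists_isWeierstrassFactorization hL₀'
  obtain ⟨hΦdist, hΦdeg⟩ := isDistinguishedAt_powerMap (p := p)
  have hΦdeg0 : ((1 + Polynomial.X : Polynomial (unrIntegers p)) ^ p - 1).natDegree ≠ 0 := by
    rw [hΦdeg]; exact hp0
  -- the two sides are (distinguished) × (unit), up to scalars
  have H_L : PowerSeries.IsWeierstrassFactorization
      ((L₀'.subst ((1 + X : UnrSeries p) ^ p - 1) * L₀ ^ p : UnrSeries p))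
      (P'.comp ((1 + Polynomial.X : Polynomial (unrIntegers p)) ^ p - 1) * P ^ p)
      (v'.subst ((1 + X : UnrSeries p) ^ p - 1) * v ^ p) :=
    (isWeierstrassFactorization_subst_powerMap HPv').mul (isWeierstrassFactorization_pow HPv hp0)
  have H_R : (L₀' ^ p * L₀.subst ((1 + X : UnrSeries p) ^ p - 1)).IsWeierstrassFactorization
      (P' ^ p * P.comp ((1 + Polynomial.X : Polynomial (unrIntegers p)) ^ p - 1))
      (v' ^ p * v.subst ((1 + X : UnrSeries p) ^ p - 1)) :=
    (isWeierstrassFactorization_pow HPv' hp0).mul (isWeierstrassFactorization_subst_powerMap HPv)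
  -- the degrees of the two distinguished polynomials agree
  have hPm := HPv.isDistinguishedAt.monic
  have hP'm := HPv'.isDistinguishedAt.monic
  have hNeq : (P' ^ p * P.comp ((1 + Polynomial.X : Polynomial (unrIntegers p)) ^ p - 1)).natDegree =
      (P'.comp ((1 + Polynomial.X : Polynomial (unrIntegers p)) ^ p - 1) * P ^ p).natDegree := by
    rw [Polynomial.Monic.natDegree_mul (hP'm.pow p) (hPm.comp hΦdist.monic hΦdeg0),
      Polynomial.Monic.natDegree_mul (hP'm.comp hΦdist.monic hΦdeg0) (hPm.pow p),
      Polynomial.natDegree_comp, Polynomial.natDegree_comp, Polynomial.Monic.natDegree_pow hPm,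
      Polynomial.Monic.natDegree_pow hP'm, hΦdeg]
    ring
  -- top coefficients are units
  have huL := isUnit_coeff_natDegree H_L
  have huR := isUnit_coeff_natDegree H_R
  rw [hNeq] at huR
  obtain ⟨uL, huLeq⟩ := huL
  obtain ⟨uR, huReq⟩ := huR
  -- rewrite the identity with the `p`-contents pulled out
  have hsub' : L'.subst ((1 + X : UnrSeries p) ^ p - 1) =
      PowerSeries.C (((p : ℕ) : unrIntegers p) ^ μ') * L₀'.subst ((1 + X : UnrSeries p) ^ p - 1) := by
    rw [hLμ', subst_C_mul_one_add_X_pow_sub_one]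
  have hsub : L.subst ((1 + X : UnrSeries p) ^ p - 1) =
      PowerSeries.C (((p : ℕ) : unrIntegers p) ^ μ) * L₀.subst ((1 + X : UnrSeries p) ^ p - 1) := by
    rw [hLμ, subst_C_mul_one_add_X_pow_sub_one]
  rw [hsub', hsub] at hid
  rw [hLμ', hLμ] at hid
  simp only [map_mul, map_pow, PowerSeries.map_C] at hid
  have E1 : PowerSeries.C (θ * (unrIntegers p).subtype ((p : ℕ) : unrIntegers p) ^ (μ' + p * μ)) *
      PowerSeries.map (unrIntegers p).subtype (L₀'.subst ((1 + X : UnrSeries p) ^ p - 1) * L₀ ^ p) =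
      PowerSeries.C ((unrIntegers p).subtype ((p : ℕ) : unrIntegers p) ^ (p * μ' + μ)) *
      PowerSeries.map (unrIntegers p).subtype (L₀' ^ p * L₀.subst ((1 + X : UnrSeries p) ^ p - 1)) := by
    simp only [map_mul, map_pow]
    linear_combination hid
  -- the coefficient of `T^N`
  have E2 := congrArg (coeff (P'.comp ((1 + Polynomial.X : Polynomial (unrIntegers p)) ^ p - 1) *
    P ^ p).natDegree) E1
  simp only [coeff_C_mul, coeff_map, ← huLeq, ← huReq] at E2
  -- `E2 : θ ι(p)^a * ι uL = ι(p)^b * ι uR`; the unit `ω := uR · uL⁻¹`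
  have hinv : (unrIntegers p).subtype ((uL⁻¹ : (unrIntegers p)ˣ) : unrIntegers p) *
      (unrIntegers p).subtype (uL : unrIntegers p) = 1 := by
    rw [← map_mul, Units.inv_mul, map_one]
  have hωu : IsUnit ((uR : unrIntegers p) * ((uL⁻¹ : (unrIntegers p)ˣ) : unrIntegers p)) :=
    (Units.isUnit uR).mul (Units.isUnit uL⁻¹)
  have E3 : θ * (unrIntegers p).subtype ((p : ℕ) : unrIntegers p) ^ (μ' + p * μ) =
      (unrIntegers p).subtype ((p : ℕ) : unrIntegers p) ^ (p * μ' + μ) *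
        (unrIntegers p).subtype ((uR : unrIntegers p) * ((uL⁻¹ : (unrIntegers p)ˣ) : unrIntegers p)) := by
    calc θ * (unrIntegers p).subtype ((p : ℕ) : unrIntegers p) ^ (μ' + p * μ)
        = θ * (unrIntegers p).subtype ((p : ℕ) : unrIntegers p) ^ (μ' + p * μ) *
            ((unrIntegers p).subtype ((uL⁻¹ : (unrIntegers p)ˣ) : unrIntegers p) *
              (unrIntegers p).subtype (uL : unrIntegers p)) := by rw [hinv, mul_one]
      _ = (θ * (unrIntegers p).subtype ((p : ℕ) : unrIntegers p) ^ (μ' + p * μ) *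
            (unrIntegers p).subtype (uL : unrIntegers p)) *
            (unrIntegers p).subtype ((uL⁻¹ : (unrIntegers p)ˣ) : unrIntegers p) := by ring
      _ = ((unrIntegers p).subtype ((p : ℕ) : unrIntegers p) ^ (p * μ' + μ) *
            (unrIntegers p).subtype (uR : unrIntegers p)) *
            (unrIntegers p).subtype ((uL⁻¹ : (unrIntegers p)ˣ) : unrIntegers p) := by rw [E2]
      _ = _ := by rw [map_mul]; ring
  -- substitute and cancel the scalar `ι(p)^b`
  have hCb : (PowerSeries.C ((unrIntegers p).subtype ((p : ℕ) : unrIntegers p) ^ (p * μ' + μ)) :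
      PowerSeries ℂ_[p]) ≠ 0 := by
    rw [Ne, map_eq_zero_iff _ (C_injective (R := ℂ_[p]))]
    exact pow_ne_zero _ ((map_ne_zero_iff _ hι).mpr hπ0)
  have E4 : PowerSeries.map (unrIntegers p).subtype
      (PowerSeries.C ((uR : unrIntegers p) * ((uL⁻¹ : (unrIntegers p)ˣ) : unrIntegers p)) *
        (L₀'.subst ((1 + X : UnrSeries p) ^ p - 1) * L₀ ^ p)) =
      PowerSeries.map (unrIntegers p).subtype (L₀' ^ p * L₀.subst ((1 + X : UnrSeries p) ^ p - 1)) := by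
    apply mul_left_cancel₀ hCb
    rw [map_mul, PowerSeries.map_C, ← mul_assoc, ← map_mul, ← E3, E1]
  have E5 : PowerSeries.C ((uR : unrIntegers p) * ((uL⁻¹ : (unrIntegers p)ˣ) : unrIntegers p)) *
      (L₀'.subst ((1 + X : UnrSeries p) ^ p - 1) * L₀ ^ p) =
      L₀' ^ p * L₀.subst ((1 + X : UnrSeries p) ^ p - 1) :=
    PowerSeries.map_injective _ hι E4
  -- uniqueness of Weierstrass factorization: the polynomial parts agree
  have H_L' : (L₀' ^ p * L₀.subst ((1 + X : UnrSeries p) ^ p - 1)).IsWeierstrassFactorization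
      (P'.comp ((1 + Polynomial.X : Polynomial (unrIntegers p)) ^ p - 1) * P ^ p)
      (((uR : unrIntegers p) * ((uL⁻¹ : (unrIntegers p)ˣ) : unrIntegers p)) •
        (v'.subst ((1 + X : UnrSeries p) ^ p - 1) * v ^ p)) := by
    have := H_L.smul hωu
    rwa [smul_eq_C_mul, E5] at this
  obtain ⟨hQQ, -⟩ := PowerSeries.IsWeierstrassFactorization.elim H_R H_L'
  -- the polynomial rigidity in `ℂ_p[X]` forces `P = P'`
  have hPeq : P = P' := by
    apply Polynomial.map_injective (unrIntegers p).subtype hι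
    have hm := congrArg (Polynomial.map (unrIntegers p).subtype) hQQ
    simp only [Polynomial.map_mul, Polynomial.map_pow, Polynomial.map_comp, Polynomial.map_sub,
      Polynomial.map_add, Polynomial.map_one, Polynomial.map_X] at hm
    exact eq_of_comp_powerMap_mul_pow_eq (hPm.map _) (hP'm.map _)
      (fun α hα ↦ norm_root_lt_one_of_isDistinguishedAt HPv.isDistinguishedAt hα)
      (fun α hα ↦ norm_root_lt_one_of_isDistinguishedAt HPv'.isDistinguishedAt hα) hm.symm
  subst hPeq
  -- conclusion: `p^μ 𝓛' = p^{μ'} (v' v⁻¹) 𝓛`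
  obtain ⟨vi, hvi⟩ := HPv.isUnit.exists_right_inv
  refine ⟨μ, μ', v' * vi, HPv'.isUnit.mul (IsUnit.of_mul_eq_one_right _ hvi), ?_⟩
  rw [hLμ', hLμ, HPv'.eq_mul, HPv.eq_mul]
  have key : v' * vi * (PowerSeries.C (((p : ℕ) : unrIntegers p) ^ μ) * ((P : UnrSeries p) * v)) =
      PowerSeries.C (((p : ℕ) : unrIntegers p) ^ μ) * ((P : UnrSeries p) * v') * (v * vi) := by ring
  rw [key, hvi, mul_one]
  ring

end Summit.BirchSwinnertonDyer.BirchSwinnertonDyer.Theorems.CongruentShaFreeCutPowerMapSeriesRigidity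

end
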